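import Summits.Ventures.HodgeRepro2.T5SU11JacobiPhaseTailGroup
import Summits.Ventures.HodgeRepro2.T5SU11OrbitRadiusLaw

/-!
# The radial law of the orbit point in closed form:
`P_{k,λ}(|g·0|² > y) = π ∫_y^1 (1 − t)^{k/2 − 2} Φ_λ(−½ log(1 − t)) dt / m̂_k(λ)`

The change of variables `s = −½ log(1 − t)` (`t = |g·0|² = 1 − e^{−2s}`, `ds = dt/(2(1 − t))`) in the tail of
the phase (`T5SU11JacobiPhaseTailGroup.integral_phase_tail_eq`) turns the Laplace-type integral
`2π ∫_x^∞ e^{−(k−2)s} Φ_λ(s) ds` into an integral over the radial variable on `(y, 1)`: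

  **`∫_{−½ log(1−y)}^∞ e^{−(k−2)s} Φ_λ(s) ds = ½ ∫_y^1 (1 − t)^{k/2 − 2} Φ_λ(−½ log(1 − t)) dt`**
  (`integral_phase_tail_eq_radial`; Mathlib's `integral_image_eq_integral_abs_deriv_smul`), hence

  **`∫_{|g·0|² > y} m_k φ_λ dν = π ∫_y^1 (1 − t)^{k/2 − 2} Φ_λ(−½ log(1 − t)) dt`**   (`integral_orbit_sq_tail_eq`)

for `k` on the ray and `0 ≤ y < 1`: the squared orbit radius has, under `m_k φ_λ dν / m̂_k(λ)`, the density
`π (1 − t)^{k/2 − 2} Φ_λ(−½ log(1 − t)) / m̂_k(λ)` on `(0, 1)` for every spectral parameter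
(`orbit_sq_tail_prob_eq`) — the `Beta(1, (k−2)/2)` law of `T5SU11OrbitRadiusLaw` is the case `λ = 0`
(`Φ_0 ≡ 1`), and the radial density is the angular integral of the area density of
`T5SU11JacobiOrbitDiscLaw`. Nothing is claimed about (N).

Blind lane: Mathlib + the HodgeRepro2 prefix only; no sorry; axioms ⊆ {propext, Classical.choice,
Quot.sound}.
-/

namespace Summit.Ventures.HodgeRepro2.T5SU11JacobiOrbitRadialLaw

open MeasureTheory MeasureTheory.Measure Metric Set Filter Topology
open T5SU11Unimodular T5SU11Fibration T5SU11Cartan T5SU11OneParameter T5SU11CartanProjection T5HaarCircle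
  T5BergmanCoefficient T5SU11FibrationHaar T5SU11SphericalFunction T5SU11SphericalSymmetry
  T5SU11SphericalBounds T5SU11SphericalContinuous T5SU11JacobiIwasawa T5SU11JacobiTransform
  T5SU11JacobiWeight T5SU11KFiniteMajorantPow T5SU11PhaseLaw T5SU11PhaseLawLintegral
  T5SU11JacobiLaplacePhase T5SU11PhaseTail T5SU11JacobiPhaseTailGroup T5SU11OrbitRadiusLaw
open scoped Real

/-! ### The change of variables `s = −½ log(1 − t)` on `(y, 1)` -/

/-- The map `t ↦ −½ log(1 − t)` sends `(y, 1)` onto `(−½ log(1 − y), ∞)` for `y < 1`. -/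
theorem image_neg_half_log_one_sub {y : ℝ} (hy : y < 1) :
    (fun t : ℝ => -(1 / 2) * Real.log (1 - t)) '' Ioo y 1 = Ioi (-(1 / 2) * Real.log (1 - y)) := by
  ext s
  simp only [mem_image, mem_Ioo, mem_Ioi]
  constructor
  · rintro ⟨t, ⟨hyt, ht1⟩, rfl⟩
    have h1 : 0 < 1 - t := by linarith
    have h2 : 1 - t < 1 - y := by linarith
    have := Real.log_lt_log h1 h2
    linarith
  · intro hs
    refine ⟨1 - Real.exp (-(2 * s)), ⟨?_, ?_⟩, ?_⟩
    · -- `y < 1 − e^{−2s}` ⟺ `e^{−2s} < 1 − y` ⟺ `−2s < log(1 − y)` ⟺ `s > −½ log(1 − y)`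
      have h1 : 0 < 1 - y := by linarith
      have : Real.exp (-(2 * s)) < 1 - y := by
        rw [← Real.exp_log h1]
        exact Real.exp_lt_exp.mpr (by linarith)
      linarith
    · have := Real.exp_pos (-(2 * s))
      linarith
    · rw [sub_sub_cancel, Real.log_exp]
      ring

/-- `t ↦ −½ log(1 − t)` is injective on `(y, 1)`. -/
theorem injOn_neg_half_log_one_sub (y : ℝ) :
    InjOn (fun t : ℝ => -(1 / 2) * Real.log (1 - t)) (Ioo y 1) := by
  intro t₁ ht₁ t₂ ht₂ h
  simp only at h
  have h1 : 0 < 1 - t₁ := by linarith [ht₁.2]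
  have h2 : 0 < 1 - t₂ := by linarith [ht₂.2]
  have : Real.log (1 - t₁) = Real.log (1 - t₂) := by linarith
  have := Real.log_injOn_pos (mem_Ioi.mpr h1) (mem_Ioi.mpr h2) this
  linarith

/-- The derivative of `t ↦ −½ log(1 − t)` on `(y, 1)` is `1/(2(1 − t))`. -/
theorem hasDerivWithinAt_neg_half_log_one_sub {y t : ℝ} (ht : t ∈ Ioo y 1) :
    HasDerivWithinAt (fun t : ℝ => -(1 / 2) * Real.log (1 - t)) (1 / (2 * (1 - t))) (Ioo y 1) t := by
  have h1 : 1 - t ≠ 0 := by linarith [ht.2]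
  have hd : HasDerivAt (fun t : ℝ => Real.log (1 - t)) ((1 - t)⁻¹ * (-1)) t :=
    (Real.hasDerivAt_log h1).comp t ((hasDerivAt_id t).const_sub 1)
  have := (hd.const_mul (-(1 / 2))).hasDerivWithinAt (s := Ioo y 1)
  refine this.congr_deriv ?_
  field_simp

/-- `e^{−(k−2)(−½ log(1 − t))} = (1 − t)^{(k−2)/2}` for `t < 1`. -/
theorem exp_neg_mul_neg_half_log {k t : ℝ} (ht : t < 1) :
    Real.exp (-((k - 2) * (-(1 / 2) * Real.log (1 - t)))) = (1 - t) ^ ((k - 2) / 2) := by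
  rw [Real.rpow_def_of_pos (by linarith)]
  congr 1
  ring

section measure

variable [MeasurableSpace Circle] [BorelSpace Circle]

omit [BorelSpace Circle] in
/-- **The phase tail in the radial variable**: for `k` on the ray and `y < 1`,
`∫_{−½ log(1−y)}^∞ e^{−(k−2)s} Φ_λ(s) ds = ½ ∫_y^1 (1 − t)^{k/2 − 2} Φ_λ(−½ log(1 − t)) dt`. -/
theorem integral_phase_tail_eq_radial (k lam : ℝ) {y : ℝ} (hy : y < 1) :
    ∫ s in Ioi (-(1 / 2) * Real.log (1 - y)), Real.exp (-((k - 2) * s)) * sphPhase lam s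
      = 1 / 2 * ∫ t in Ioo y 1, (1 - t) ^ (k / 2 - 2) * sphPhase lam (-(1 / 2) * Real.log (1 - t)) := by
  rw [← image_neg_half_log_one_sub hy,
    integral_image_eq_integral_abs_deriv_smul measurableSet_Ioo
      (fun t ht => hasDerivWithinAt_neg_half_log_one_sub ht) (injOn_neg_half_log_one_sub y),
    ← integral_const_mul]
  refine setIntegral_congr_fun measurableSet_Ioo fun t ht => ?_
  simp only [smul_eq_mul]
  have h1 : 0 < 1 - t := by linarith [ht.2]
  rw [abs_of_pos (by positivity), exp_neg_mul_neg_half_log ht.2,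
    show k / 2 - 2 = (k - 2) / 2 - 1 by ring, Real.rpow_sub_one h1.ne']
  field_simp

/-- **THE RADIAL LAW IN CLOSED FORM**: for `k` on the ray and `0 ≤ y < 1`,
`∫_{|g·0|² > y} m_k φ_λ dν = π ∫_y^1 (1 − t)^{k/2 − 2} Φ_λ(−½ log(1 − t)) dt`. -/
theorem integral_orbit_sq_tail_eq {k lam : ℝ} (hk : 1 < k) (h1 : lam < k) (h2 : 2 < k + lam) {y : ℝ}
    (hy0 : 0 ≤ y) (hy1 : y < 1) :
    ∫ g in {g : SU11 | y < ‖orbit g‖ ^ 2}, (1 - ‖orbit g‖ ^ 2) ^ (k / 2) * sph lam g ∂(nu haarCircle)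
      = π * ∫ t in Ioo y 1, (1 - t) ^ (k / 2 - 2) * sphPhase lam (-(1 / 2) * Real.log (1 - t)) := by
  have hx : 0 ≤ -(1 / 2) * Real.log (1 - y) := by
    have := Real.log_nonpos (by linarith) (by linarith : 1 - y ≤ 1)
    linarith
  rw [setOf_norm_orbit_sq_gt_eq hy1, integral_phase_tail_eq hk h1 h2 hx,
    integral_phase_tail_eq_radial k lam hy1]
  ring

/-- **The radial tail probability**: for `k` on the ray and `0 ≤ y < 1`,
`P_{k,λ}(|g·0|² > y) = π ∫_y^1 (1 − t)^{k/2 − 2} Φ_λ(−½ log(1 − t)) dt / m̂_k(λ)`. -/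
theorem orbit_sq_tail_prob_eq {k lam : ℝ} (hk : 1 < k) (h1 : lam < k) (h2 : 2 < k + lam) {y : ℝ}
    (hy0 : 0 ≤ y) (hy1 : y < 1) :
    (∫ g in {g : SU11 | y < ‖orbit g‖ ^ 2}, (1 - ‖orbit g‖ ^ 2) ^ (k / 2) * sph lam g ∂(nu haarCircle))
        / ∫ g, (1 - ‖orbit g‖ ^ 2) ^ (k / 2) * sph lam g ∂(nu haarCircle)
      = π * (∫ t in Ioo y 1, (1 - t) ^ (k / 2 - 2) * sphPhase lam (-(1 / 2) * Real.log (1 - t)))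
        / ∫ g, (1 - ‖orbit g‖ ^ 2) ^ (k / 2) * sph lam g ∂(nu haarCircle) := by
  rw [integral_orbit_sq_tail_eq hk h1 h2 hy0 hy1]

end measure

end Summit.Ventures.HodgeRepro2.T5SU11JacobiOrbitRadialLaw
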